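import Summits.SmoothPoincare4.SmoothPoincare4.Theorems.CylinderEntropyCylinderRungTwoKillingFluxDefs
import Summits.SmoothPoincare4.SmoothPoincare4.Theorems.CylinderEntropyCylinderRungTwoRelaxationOfAreaToFloor
import Summits.SmoothPoincare4.SmoothPoincare4.Theorems.CylinderEntropyCylinderRungTwoHamiltonMonotonicity
import Summits.SmoothPoincare4.SmoothPoincare4.Theorems.CylinderEntropySliceIsolationStubDominationBookkeeping
import Summits.SmoothPoincare4.SmoothPoincare4.Theorems.CylinderEntropySliceIsolationStubConformalEmbedding
import Summits.SmoothPoincare4.SmoothPoincare4.Theorems.CylinderEntropySliceIsolationReductionCertificates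
import Literature.Geometry.Riemannian.LowEntropyHypersurfacesFourAssembly
import Literature.Geometry.Riemannian.LowEntropyHypersurfacesFourProofs
import Literature.Geometry.Riemannian.SphericalCylinderEntropy
import HarnessLib

/-!
# Route `CylinderEntropy`, crux `CylinderRungTwo` (stmt-SmoothPoincare4-7631), line `killing-flux`, reshape r15:
# RECOGNITION OF IMMORTAL LEAVES of the surgery tree

The finite-time half of the crux is, since lead reshape r15, a mean curvature flow with neck surgery in `N = S⁴ × ℝ` whose
surviving components are IMMORTAL smooth flows of thin end-separating cross-sections (`immortal` leaves of
`CylNeckSurgeryResolvable`, vocabulary file `…CylinderRungTwoSurgeryDefs.lean`).  The topology of the surgery tree needs every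
such leaf that is SIMPLY CONNECTED (compact, connected) to be a standard `S⁴`.  This file PROVES that recognition from the
immortal half of the line and one published Euclidean theorem:

* `helper_simplyConnectedRecognition` — from Chodosh–Mantoulidis–Schulze 2025 Cor. 1.5 (b) (`n = 4`, simply connected case; the
  Literature named fact `ChodoshMantoulidisSchulze2025_cor15b_four`, carried as a hypothesis) and the mid-scale kernel
  certificates of crux 7632's line (hypothesis `hmid`; the tree's computational `certMid_all`): with `ε₀ = 4/(1.47e) − 1 > 0`,
  every compact connected simply connected cross-section `ι : P → N` with `λ_cyl(range ι) < 1 + ε₀` is `≅ S⁴`.  Proof = the proof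
  of `sliceIsolation_of_cor15b_of_certificates` (crux 7632, p132345) with `SimplyConnectedSpace P` in place of `P ≃ₕ S⁴`: the
  conformal image `Φ(range ι) ⊂ ℝ⁵`, `Φ(z) = e^{z₅} z'`, has Gaussian entropy `≤ 1.47 λ_cyl < 4/e = λ(S² × ℝ²)` (landed
  `stub_dominationBookkeeping`), `Φ ∘ ι` is a smooth embedding (landed `stub_conformalEmbedding`), and Cor. 1.5 (b) concludes.  No
  separation hypothesis is used.
* `helper_immortalLeafRecognition` — from the immortal half `AreaToFloor` (registered stub `stub_areaToFloor` = route crux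
  ImmortalAreaToFloor, stmt-SmoothPoincare4-17197, carried as a hypothesis), Hamilton's monotonicity (LANDED
  `stub_hamiltonMonotonicity`) and the landed relaxation glue `stub_relaxationOfAreaToFloor`: along an immortal thin separating
  flow of a compact connected simply connected `P` some late slice has `λ_cyl < 1 + ε₀`, and the first bullet applies.

Both theorems are CONDITIONAL exactly on their displayed hypotheses (the gate records them as such); no `sorry`, no definition,
no new named fact.

References: O. Chodosh, C. Mantoulidis, F. Schulze, Duke Math. J. 174 (2025), arXiv:2309.03856, Cor. 1.5 (b); R. S. Hamilton,
Comm. Anal. Geom. 1 (1993) 127–137, Thm. 4.1.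
-/

noncomputable section

-- the registered namespace repeats a component
set_option linter.dupNamespace false

open MeasureTheory Set
open scoped Manifold ContDiff ENNReal Topology BigOperators

namespace Summit.SmoothPoincare4.SmoothPoincare4.Cruxes.CylinderRungTwo.KillingFlux

open Literature.Geometry.Riemannian
open Literature.Geometry.Riemannian.SphericalCylinderEntropy (cylEntropy zonal)
open Summit.SmoothPoincare4.SmoothPoincare4.Theorems.CylinderEntropySliceIsolation
  (stub_dominationBookkeeping stub_conformalEmbedding reductionCertificates_certAll reductionCertificates_sphereEntropy_le)

/-- **Registered helper `helper_simplyConnectedRecognition`** — recognition of nearly calibrated SIMPLY CONNECTED cross-sections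
from Cor. 1.5 (b) and the mid-scale kernel certificates: there is `ε > 0` (namely `4/(1.47e) − 1`) such that every compact
connected simply connected cross-section `ι : P → N` with `λ_cyl(range ι) < 1 + ε` is diffeomorphic to `S⁴`.
[cite: ChodoshMantoulidisSchulze2025, Cor. 1.5 (b) and Cor. 1.22 (b) (n = 4)] -/
theorem helper_simplyConnectedRecognition :
    Literature.Geometry.Riemannian.ChodoshMantoulidisSchulze2025_cor15b_four →
    (∀ T : ℝ, 1 / 100 ≤ T → T ≤ 10 →
      ∃ (n : ℕ) (σ τ w : Fin n → ℝ) (c : ℝ), (∀ j, 0 < τ j) ∧ (∀ j, 0 ≤ w j) ∧ 0 ≤ c ∧ (∑ j, w j) + c ≤ 147 / 100 ∧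
        ∀ u s : ℝ, -1 ≤ s → s ≤ 1 →
          (8 * Real.pi ^ 2 / 3) * ((4 * Real.pi * T) ^ 2)⁻¹ * Real.exp (4 * u) *
              Real.exp (-(Real.exp (2 * u) - 2 * Real.exp u * s + 1) / (4 * T)) ≤
            (∑ j, w j * (Literature.Geometry.Riemannian.SphericalCylinderEntropy.zonal (τ j) s *
              Real.exp (-(u - σ j) ^ 2 / (4 * τ j)))) + c) →
    ∃ ε : ℝ, 0 < ε ∧ ∀ (P : Type) [TopologicalSpace P] [T2Space P] [SecondCountableTopology P]
      [ChartedSpace (EuclideanSpace ℝ (Fin 4)) P] [IsManifold (𝓡 4) ∞ P] [CompactSpace P] [ConnectedSpace P],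
      SimplyConnectedSpace P → ∀ ι : P → EuclideanSpace ℝ (Fin 6), Manifold.IsSmoothEmbedding (𝓡 4) (𝓡 6) ∞ ι →
      (∀ x, ∑ i : Fin 5, ι x (Fin.castSucc i) ^ 2 = 1) →
      Literature.Geometry.Riemannian.SphericalCylinderEntropy.cylEntropy (Set.range ι) < ENNReal.ofReal (1 + ε) →
      Nonempty (P ≃ₘ⟮𝓡 4, 𝓡 4⟯ Metric.sphere (0 : EuclideanSpace ℝ (Fin 5)) 1) := by
  intro hb hmid
  have he0 : 0 < Real.exp 1 := Real.exp_pos 1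
  have he2 : Real.exp 1 < 2.7182818286 := Real.exp_one_lt_d9
  -- all-scales domination with constant `147/100`
  have hdom := stub_dominationBookkeeping (147 / 100) reductionCertificates_sphereEntropy_le
    (reductionCertificates_certAll hmid)
  -- the explicit `ε`
  set ε : ℝ := 4 / (147 / 100 * Real.exp 1) - 1 with hε
  have hεpos : 0 < ε := by
    rw [hε, sub_pos, lt_div_iff₀ (by positivity)]
    nlinarith
  have hCε : (147 / 100 : ℝ) * (1 + ε) = 4 / Real.exp 1 := by
    rw [hε]; field_simp; ring
  refine ⟨ε, hεpos, ?_⟩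
  intro P _ _ _ _ _ _ _ hsc ι hι hN hent
  -- the cross-section `A = range ι ⊆ N`: measurable, of bounded height
  have hAN : Set.range ι ⊆ {z : EuclideanSpace ℝ (Fin 6) | ∑ i : Fin 5, z (Fin.castSucc i) ^ 2 = 1} := by
    rintro _ ⟨x, rfl⟩
    exact hN x
  have hcpt : IsCompact (Set.range ι) := isCompact_range hι.isEmbedding.continuous
  have hAm : MeasurableSet (Set.range ι) := hcpt.isClosed.measurableSet
  have hAb : ∃ B : ℝ, ∀ z ∈ Set.range ι, |z 5| ≤ B := by
    obtain ⟨B, hB⟩ := hcpt.exists_bound_of_continuousOn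
      ((EuclideanSpace.proj (5 : Fin 6)).continuous.continuousOn)
    exact ⟨B, fun z hz => by simpa [Real.norm_eq_abs] using hB z hz⟩
  -- the Euclidean entropy of `Φ(range ι)` is at most `4/e = λ(S² × ℝ²)`
  have hbound : gaussianEntropy 4 ((fun z : EuclideanSpace ℝ (Fin 6) =>
      (WithLp.toLp 2 (fun i : Fin 5 => Real.exp (z 5) * z (Fin.castSucc i)) : EuclideanSpace ℝ (Fin 5))) '' Set.range ι) ≤
      gaussianEntropy 4 (shrinkingCylinder 4 2) := by
    calc gaussianEntropy 4 ((fun z : EuclideanSpace ℝ (Fin 6) =>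
      (WithLp.toLp 2 (fun i : Fin 5 => Real.exp (z 5) * z (Fin.castSucc i)) : EuclideanSpace ℝ (Fin 5))) '' Set.range ι)
        ≤ ENNReal.ofReal (147 / 100) * cylEntropy (Set.range ι) := hdom _ hAN hAm hAb
      _ ≤ ENNReal.ofReal (147 / 100) * ENNReal.ofReal (1 + ε) := by gcongr
      _ = ENNReal.ofReal (4 / Real.exp 1) := by
          rw [← ENNReal.ofReal_mul (by norm_num), hCε]
      _ = gaussianEntropy 4 (shrinkingCylinder 4 2) := gaussianEntropy_shrinkingCylinder_four_two.symm
  -- recognition: `Φ ∘ ι` is a smooth embedding and Cor. 1.5 (b) for the simply connected `P`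
  have hemb : Manifold.IsSmoothEmbedding (𝓡 4) (𝓡 5) ∞ ((fun z : EuclideanSpace ℝ (Fin 6) =>
      (WithLp.toLp 2 (fun i : Fin 5 => Real.exp (z 5) * z (Fin.castSucc i)) : EuclideanSpace ℝ (Fin 5))) ∘ ι) :=
    stub_conformalEmbedding P ι hι hN
  refine hb P hsc _ hemb ?_
  rwa [Set.range_comp]

/-- **Registered helper `helper_immortalLeafRecognition`** — recognition of IMMORTAL LEAVES: given the immortal half of the line
(`AreaToFloor`, the registered stub `stub_areaToFloor` = route crux ImmortalAreaToFloor, stated verbatim as the first hypothesis),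
Cor. 1.5 (b) and the mid-scale certificates, every compact connected SIMPLY CONNECTED `4`-manifold carrying an immortal smooth flow
of embedded cross-sections of `N` (`IsCylinderMCF`), every slice separating the ends with `λ_cyl < 2`, is diffeomorphic to `S⁴`:
the landed relaxation glue `stub_relaxationOfAreaToFloor stub_hamiltonMonotonicity` gives a late slice with `λ_cyl < 1 + ε₀`, to
which `helper_simplyConnectedRecognition` applies. [cite: ChodoshMantoulidisSchulze2025, Cor. 1.5 (b)] [cite: Hamilton1993, Thm. 4.1] -/
theorem helper_immortalLeafRecognition :
    (∀ (M : Type) [TopologicalSpace M] [T2Space M] [SecondCountableTopology M]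
      [ChartedSpace (EuclideanSpace ℝ (Fin 4)) M] [IsManifold (𝓡 4) ∞ M] [CompactSpace M]
      [ConnectedSpace M]
      (F : ℝ → M → EuclideanSpace ℝ (Fin 6)) (ν : ℝ → M → EuclideanSpace ℝ (Fin 6)) (T : ℝ),
      IsCylinderMCF M F ν T →
      (∀ t, T ≤ t → SeparatesEnds (Set.range (F t))) →
      (∀ t, T ≤ t → Literature.Geometry.Riemannian.SphericalCylinderEntropy.cylEntropy (Set.range (F t)) < 2) →
      ∀ ε : ℝ, 0 < ε → ∃ t : ℝ, T ≤ t ∧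
        μH[4] (Set.range (F t)) ≤
          ENNReal.ofReal (1 + ε) * μH[4] (Metric.sphere (0 : EuclideanSpace ℝ (Fin 5)) 1)) →
    Literature.Geometry.Riemannian.ChodoshMantoulidisSchulze2025_cor15b_four →
    (∀ T : ℝ, 1 / 100 ≤ T → T ≤ 10 →
      ∃ (n : ℕ) (σ τ w : Fin n → ℝ) (c : ℝ), (∀ j, 0 < τ j) ∧ (∀ j, 0 ≤ w j) ∧ 0 ≤ c ∧ (∑ j, w j) + c ≤ 147 / 100 ∧
        ∀ u s : ℝ, -1 ≤ s → s ≤ 1 →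
          (8 * Real.pi ^ 2 / 3) * ((4 * Real.pi * T) ^ 2)⁻¹ * Real.exp (4 * u) *
              Real.exp (-(Real.exp (2 * u) - 2 * Real.exp u * s + 1) / (4 * T)) ≤
            (∑ j, w j * (Literature.Geometry.Riemannian.SphericalCylinderEntropy.zonal (τ j) s *
              Real.exp (-(u - σ j) ^ 2 / (4 * τ j)))) + c) →
    ∀ (P : Type) [TopologicalSpace P] [T2Space P] [SecondCountableTopology P]
      [ChartedSpace (EuclideanSpace ℝ (Fin 4)) P] [IsManifold (𝓡 4) ∞ P] [CompactSpace P] [ConnectedSpace P],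
      SimplyConnectedSpace P →
      ∀ (F : ℝ → P → EuclideanSpace ℝ (Fin 6)) (ν : ℝ → P → EuclideanSpace ℝ (Fin 6)) (T : ℝ),
      IsCylinderMCF P F ν T →
      (∀ t, T ≤ t → SeparatesEnds (Set.range (F t))) →
      (∀ t, T ≤ t → Literature.Geometry.Riemannian.SphericalCylinderEntropy.cylEntropy (Set.range (F t)) < 2) →
      Nonempty (P ≃ₘ⟮𝓡 4, 𝓡 4⟯ Metric.sphere (0 : EuclideanSpace ℝ (Fin 5)) 1) := by
  intro hAF hb hmid
  obtain ⟨ε, hε, hrec⟩ := helper_simplyConnectedRecognition hb hmid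
  intro P _ _ _ _ _ _ _ hsc F ν T hflow hsep hent
  obtain ⟨t₀, hTt₀, hsmall⟩ := stub_relaxationOfAreaToFloor stub_hamiltonMonotonicity hAF P F ν T hflow hsep hent ε hε
  exact hrec P hsc (F t₀) (hflow.isSmoothEmbedding t₀ hTt₀) (hflow.mem_cyl t₀ hTt₀) (hsmall t₀ le_rfl)

end Summit.SmoothPoincare4.SmoothPoincare4.Cruxes.CylinderRungTwo.KillingFlux

end
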